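import Summits.ValiantsHypothesis.ValiantsHypothesis.Theses.DivisionGap
import Summits.ValiantsHypothesis.ValiantsHypothesis.Theorems.ShadowBirkhoff.Negative.Pencils

/-!
# `DivisionGap.ShadowBirkhoff` (stmt-ValiantsHypothesis-5069): what a witness must look like —
refuted variants of the crux (negative knowledge from the standing disprover)

The crux `ShadowBirkhoff` reads
`∀ c, ∃ n₀, ∀ n ≥ n₀, ∃ L : ℝ^{n×n} →ₗ ℝ², 2 ^ ((Nat.log 2 n + c) ^ c) < |vert conv L(permutation matrices)|`
(the shadow complexity `σ(DS_n)` of the Birkhoff polytope is super-quasi-polynomial; weak form of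
Hrubeš–Yehudayoff 2021, Open Problem 1).  It is definitionally
`∀ c, ∃ n₀, ∀ n ≥ n₀, ∃ L, 2 ^ ((Nat.log 2 n + c) ^ c) < birkhoffShadowVertexCount L`
(`Literature/Computability/AlgebraicComplexity/BirkhoffShadow.lean`).  The tree proves the sandwich
`2^{(log₂ n)²/100} ≤ σ(DS_n) ≤ 4·16^n` (both halves of HY21 Prop. 23); the crux lies strictly inside,
and its negation (a quasi-polynomial upper bound on the break points of the parametric assignment
problem) is open as well (HY21 p. 9:3; even the τ-conjecture for Newton polygons only yields
`2^{O(√n log² n)}`, HY21 Cor. 50).  All statements below are INLINE variants of the crux (no new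
named facts); the counting tools are in the sibling file `Pencils`:

* `birkhoffShadowVertexCount_le_of_entries_le` — an INTEGER projection with entries of absolute
  value `≤ M` has at most `8nM + 4` shadow vertices; hence `shadowBirkhoff_false_with_boundedInt`
  (entries `≤ n^k`) and, sharper, `shadowBirkhoff_false_with_qpBoundedInt` (entries
  `≤ 2^{(log₂ n)^k}`, polylogarithmic bit length) — both variants of the crux are false for every
  `k`.  Any witness needs coordinate functionals with super-quasi-polynomially many values on
  `S_n`; integer witnesses need bit length `(log n)^{ω(1)}` (the Carstensen-type witness of the
  tree's lower bound has bit length `Θ(log² n)` for its `2^{Θ(log² n)}` vertices — bit length and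
  log-count must grow together).
* `shadowBirkhoff_false_forall_L` — the `∀ L` strengthening is false (`L = 0`).
* `shadowBirkhoff_false_uniform` — with the quantifiers swapped (`∃ n₀ ∀ c`) it is false
  (the threshold is unbounded in `c`, the count is at most `4·16^{n₀}`).
* `shadowBirkhoff_false_for_functions` — **the injectivity coupling is load-bearing**: replacing
  the permutation matrices by the `n^n` FUNCTION matrices (all maps `Fin n → Fin n`; vertices of
  `Newt(∏_j ∑_i x_ij)`, a product of simplices, whose shadow is the Minkowski sum of the `n` column
  point sets) leaves at most `4(n² + 1)` vertices (Minkowski sums only add), and that variant of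
  the crux is false.  Faces/products/disjoint unions of gadgets never multiply vertex counts.

See `Cruxes/ShadowBirkhoff/Disproof.lean` for the running account of why the crux itself resists.
-/

noncomputable section

open scoped Pointwise

namespace Summit.ValiantsHypothesis.Theorems.ShadowBirkhoffNegative

open Literature.Computability.AlgebraicComplexity

/-! ## Integer projections with polynomially bounded entries never witness the crux -/

/-- With integer entries of absolute value `≤ M`, each coordinate of `L` takes at most
`2nM + 1` values on the permutation matrices. [folklore] -/
theorem ncard_values_le_of_entries_le {n : ℕ} (M : ℕ) (L : (Fin n × Fin n → ℝ) →ₗ[ℝ] (Fin 2 → ℝ))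
    (hL : ∀ (ij : Fin n × Fin n) (i : Fin 2), ∃ z : ℤ, L (Pi.single ij 1) i = z ∧ |z| ≤ (M : ℤ))
    (i : Fin 2) :
    ((fun p => p i) '' (L '' permMatrixPoints n)).ncard ≤ 2 * (n * M) + 1 := by
  choose z hz using hL
  set B : ℤ := (n : ℤ) * M with hB
  have hsub : (fun p => p i) '' (L '' permMatrixPoints n) ⊆
      ((↑) : ℤ → ℝ) '' (↑(Finset.Icc (-B) B) : Set ℤ) := by
    rintro _ ⟨p, hp, rfl⟩
    rw [HrubesYehudayoff2021Prop23.image_permMatrixPoints_eq_range] at hp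
    obtain ⟨e, rfl⟩ := hp
    refine ⟨∑ x, z (e x, x) i, ?_, ?_⟩
    · have hb : |∑ x, z (e x, x) i| ≤ B := by
        calc |∑ x, z (e x, x) i| ≤ ∑ x, |z (e x, x) i| := Finset.abs_sum_le_sum_abs _ _
          _ ≤ ∑ _x : Fin n, (M : ℤ) := Finset.sum_le_sum fun x _ => (hz (e x, x) i).2
          _ = B := by
              rw [Finset.sum_const, Finset.card_univ, Fintype.card_fin, nsmul_eq_mul, hB]
      rw [Finset.mem_coe, Finset.mem_Icc]
      exact ⟨by linarith [neg_abs_le (∑ x, z (e x, x) i)], (le_abs_self _).trans hb⟩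
    · dsimp only
      rw [Finset.sum_apply, Int.cast_sum]
      exact Finset.sum_congr rfl fun x _ => (hz (e x, x) i).1.symm
  calc ((fun p => p i) '' (L '' permMatrixPoints n)).ncard
      ≤ (((↑) : ℤ → ℝ) '' (↑(Finset.Icc (-B) B) : Set ℤ)).ncard :=
        Set.ncard_le_ncard hsub ((Finset.finite_toSet _).image _)
    _ = (Finset.Icc (-B) B).card := by
        rw [Set.ncard_image_of_injective _ Int.cast_injective, Set.ncard_coe_finset]
    _ = 2 * (n * M) + 1 := by
        rw [Int.card_Icc]
        have : B + 1 - -B = ((2 * (n * M) + 1 : ℕ) : ℤ) := by push_cast; rw [hB]; ring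
        rw [this, Int.toNat_natCast]

/-- **Counting form.** An integer projection with entries of absolute value `≤ M` has at most
`8nM + 4` shadow vertices. [folklore] -/
theorem birkhoffShadowVertexCount_le_of_entries_le {n : ℕ} (M : ℕ)
    (L : (Fin n × Fin n → ℝ) →ₗ[ℝ] (Fin 2 → ℝ))
    (hL : ∀ (ij : Fin n × Fin n) (i : Fin 2), ∃ z : ℤ, L (Pi.single ij 1) i = z ∧ |z| ≤ (M : ℤ)) :
    birkhoffShadowVertexCount L ≤ 8 * (n * M) + 4 := by
  have h := birkhoffShadowVertexCount_le_values L
  have h0 := ncard_values_le_of_entries_le M L hL 0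
  have h1 := ncard_values_le_of_entries_le M L hL 1
  omega

/-- Polynomially bounded entries `≤ n^k`: at most `8n^{k+1} + 4` shadow vertices. [folklore] -/
theorem birkhoffShadowVertexCount_le_of_boundedInt {n k : ℕ}
    (L : (Fin n × Fin n → ℝ) →ₗ[ℝ] (Fin 2 → ℝ))
    (hL : ∀ (ij : Fin n × Fin n) (i : Fin 2), ∃ z : ℤ, L (Pi.single ij 1) i = z ∧ |z| ≤ (n : ℤ) ^ k) :
    birkhoffShadowVertexCount L ≤ 8 * n ^ (k + 1) + 4 := by
  have h := birkhoffShadowVertexCount_le_of_entries_le (n ^ k) L (by exact_mod_cast hL)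
  calc birkhoffShadowVertexCount L ≤ 8 * (n * n ^ k) + 4 := h
    _ = 8 * n ^ (k + 1) + 4 := by rw [pow_succ]; ring

/-- **Bounded integer witnesses are load-bearing-ly absent.** The crux with its witness `L`
restricted to integer matrix entries of absolute value `≤ n^k` is false, for every `k`: a witness of
`ShadowBirkhoff` needs coordinate functionals with super-quasi-polynomially many values on `S_n`.
[folklore] -/
theorem shadowBirkhoff_false_with_boundedInt (k : ℕ) :
    ¬ ∀ c : ℕ, ∃ n₀ : ℕ, ∀ n ≥ n₀, ∃ L : (Fin n × Fin n → ℝ) →ₗ[ℝ] (Fin 2 → ℝ),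
      (∀ (ij : Fin n × Fin n) (i : Fin 2), ∃ z : ℤ, L (Pi.single ij 1) i = z ∧ |z| ≤ (n : ℤ) ^ k) ∧
        2 ^ ((Nat.log 2 n + c) ^ c) < birkhoffShadowVertexCount L := by
  intro h
  obtain ⟨n₀, hn₀⟩ := h (k + 2)
  obtain ⟨L, hL, hlt⟩ := hn₀ n₀ le_rfl
  have h1 := birkhoffShadowVertexCount_le_of_boundedInt L hL
  have h2 := poly_le_qp n₀ k
  omega

/-- **Even quasi-polynomially bounded integer entries never witness the crux.** With the witness
`L` restricted to integer entries of absolute value `≤ 2^{(log₂ n)^k}` (bit length `(log₂ n)^k`)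
the crux is false, for every `k`: such an `L` has at most `8n·2^{(log₂ n)^k} + 4` shadow vertices.
So an integer witness of `ShadowBirkhoff` needs bit length `(log n)^{ω(1)}` — super-quasi-polynomial
entries — while the Carstensen-type witness of the tree's `2^{Θ(log² n)}` lower bound has bit
length `Θ(log² n)`. [folklore] -/
theorem shadowBirkhoff_false_with_qpBoundedInt (k : ℕ) :
    ¬ ∀ c : ℕ, ∃ n₀ : ℕ, ∀ n ≥ n₀, ∃ L : (Fin n × Fin n → ℝ) →ₗ[ℝ] (Fin 2 → ℝ),
      (∀ (ij : Fin n × Fin n) (i : Fin 2), ∃ z : ℤ,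
          L (Pi.single ij 1) i = z ∧ |z| ≤ (2 : ℤ) ^ (Nat.log 2 n ^ k)) ∧
        2 ^ ((Nat.log 2 n + c) ^ c) < birkhoffShadowVertexCount L := by
  intro h
  obtain ⟨n₀, hn₀⟩ := h (k + 5)
  obtain ⟨L, hL, hlt⟩ := hn₀ n₀ le_rfl
  have h1 := birkhoffShadowVertexCount_le_of_entries_le (2 ^ (Nat.log 2 n₀ ^ k)) L
    (by exact_mod_cast hL)
  have h2 := qp_entries_le n₀ k
  omega

/-! ## Refuted strengthenings of the quantifier structure -/

/-- **`∃ L` cannot become `∀ L`.** The `∀ L` strengthening of the crux is false (the zero map is an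
integer projection with entries bounded by `n^0`). [folklore] -/
theorem shadowBirkhoff_false_forall_L :
    ¬ ∀ c : ℕ, ∃ n₀ : ℕ, ∀ n ≥ n₀, ∀ L : (Fin n × Fin n → ℝ) →ₗ[ℝ] (Fin 2 → ℝ),
      2 ^ ((Nat.log 2 n + c) ^ c) < birkhoffShadowVertexCount L := by
  intro h
  refine shadowBirkhoff_false_with_boundedInt 0 fun c => ?_
  obtain ⟨n₀, hn₀⟩ := h c
  exact ⟨n₀, fun n hn => ⟨0, fun ij i => ⟨0, by simp, by simp⟩, hn₀ n hn 0⟩⟩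

/-- **The dependence `c ↦ n₀(c)` is load-bearing.** With the quantifiers swapped (one `n₀` for all
`c`) the crux is false: at the fixed `n = n₀` every shadow has at most `4·16^{n₀}` vertices
(HY21 Prop. 23, tree `birkhoffShadowVertexCount_le`) while the threshold is unbounded in `c`.
[folklore] -/
theorem shadowBirkhoff_false_uniform :
    ¬ ∃ n₀ : ℕ, ∀ c : ℕ, ∀ n ≥ n₀, ∃ L : (Fin n × Fin n → ℝ) →ₗ[ℝ] (Fin 2 → ℝ),
      2 ^ ((Nat.log 2 n + c) ^ c) < birkhoffShadowVertexCount L := by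
  rintro ⟨n₀, h⟩
  obtain ⟨L, hlt⟩ := h (4 * n₀ + 3) n₀ le_rfl
  have h1 := HrubesYehudayoff2021Prop23.birkhoffShadowVertexCount_le L
  have h2 := exp_lt_threshold n₀ n₀
  omega

/-! ## All maps instead of bijections: Minkowski sums only add -/

/-- The projected FUNCTION matrices (entry `(i, j) = 1` iff `f j = i`, `f : Fin n → Fin n`
arbitrary) form the Minkowski sum of the `n` column point sets `{L(E_ij) : i}`. [folklore] -/
theorem image_funcMatrices_eq_sum {n : ℕ} (L : (Fin n × Fin n → ℝ) →ₗ[ℝ] (Fin 2 → ℝ)) :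
    L '' {x : Fin n × Fin n → ℝ | ∃ f : Fin n → Fin n, x = fun ij => if f ij.2 = ij.1 then 1 else 0} =
      ∑ j : Fin n, Set.range (fun i : Fin n => L (Pi.single (i, j) 1)) := by
  have hx : ∀ f : Fin n → Fin n,
      (fun ij : Fin n × Fin n => if f ij.2 = ij.1 then (1 : ℝ) else 0) =
        ∑ j, Pi.single (f j, j) (1 : ℝ) := by
    intro f
    ext ⟨i, j₀⟩
    rw [Finset.sum_apply, Finset.sum_eq_single j₀]
    · by_cases h : f j₀ = i
      · simp [h]
      · simp [h, Ne.symm h]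
    · intro j _ hj
      simp [hj.symm]
    · simp
  ext p
  rw [Set.mem_fintype_sum]
  constructor
  · rintro ⟨_, ⟨f, rfl⟩, rfl⟩
    refine ⟨fun j => L (Pi.single (f j, j) 1), fun j => ⟨f j, rfl⟩, ?_⟩
    rw [hx, map_sum]
  · rintro ⟨g, hg, rfl⟩
    choose f hf using hg
    refine ⟨_, ⟨f, rfl⟩, ?_⟩
    rw [hx, map_sum]
    exact Finset.sum_congr rfl fun j _ => hf j

/-- **Counting form.** Every planar projection of the `n^n` function matrices has at most
`4(n² + 1)` vertices (`σ(Newt ∏_j ∑_i x_ij) = O(n²)`). [folklore] -/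
theorem ncard_extremePoints_funcMatrices_le {n : ℕ} (L : (Fin n × Fin n → ℝ) →ₗ[ℝ] (Fin 2 → ℝ)) :
    (Set.extremePoints ℝ (convexHull ℝ (L '' {x : Fin n × Fin n → ℝ |
      ∃ f : Fin n → Fin n, x = fun ij => if f ij.2 = ij.1 then 1 else 0}))).ncard ≤
      4 * (1 + n * n) := by
  have hfin_j : ∀ j : Fin n, (Set.range (fun i : Fin n => L (Pi.single (i, j) 1))).Finite :=
    fun j => Set.finite_range _
  rw [image_funcMatrices_eq_sum]
  refine ncard_extremePoints_le_of_pencils _ (finite_finset_sum _ _ hfin_j) (1 + n * n)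
    fun c d => ?_
  refine (ncard_um_finset_sum_le c d _ _ hfin_j).trans ?_
  have hr : ∀ j : Fin n, (Set.range (fun i : Fin n => L (Pi.single (i, j) 1))).ncard ≤ n := by
    intro j
    rw [← Set.image_univ]
    exact (Set.ncard_image_le Set.finite_univ).trans (by rw [Set.ncard_univ, Nat.card_fin])
  have hs : ∑ j : Fin n, (Set.range (fun i : Fin n => L (Pi.single (i, j) 1))).ncard ≤ n * n :=
    (Finset.sum_le_sum fun j _ => hr j).trans
      (by rw [Finset.sum_const, Finset.card_univ, Fintype.card_fin, smul_eq_mul])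
  omega

/-- **The injectivity coupling is load-bearing.** The crux with the permutation matrices replaced
by all function matrices (`Equiv.Perm (Fin n)` ↦ `Fin n → Fin n`) is false. [folklore] -/
theorem shadowBirkhoff_false_for_functions :
    ¬ ∀ c : ℕ, ∃ n₀ : ℕ, ∀ n ≥ n₀, ∃ L : (Fin n × Fin n → ℝ) →ₗ[ℝ] (Fin 2 → ℝ),
      2 ^ ((Nat.log 2 n + c) ^ c) <
        (Set.extremePoints ℝ (convexHull ℝ (L '' {x : Fin n × Fin n → ℝ |
          ∃ f : Fin n → Fin n, x = fun ij => if f ij.2 = ij.1 then 1 else 0}))).ncard := by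
  intro h
  obtain ⟨n₀, hn₀⟩ := h 3
  obtain ⟨L, hlt⟩ := hn₀ n₀ le_rfl
  have h1 := ncard_extremePoints_funcMatrices_le L
  have h2 : 8 * n₀ ^ (1 + 1) + 4 ≤ 2 ^ ((Nat.log 2 n₀ + 3) ^ 3) := poly_le_qp n₀ 1
  have h3 : n₀ ^ (1 + 1) = n₀ * n₀ := by ring
  omega

end Summit.ValiantsHypothesis.Theorems.ShadowBirkhoffNegative

end
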